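import Summits.Ventures.PercRepro.ProfilePointedCapPlus
import Summits.Ventures.PercRepro.ProfilePointedParallelSymmetry
import Summits.Ventures.PercRepro.ProfilePointedMirror

/-!
# PercRepro — THE MIRROR STATEMENT (H) `κ_k ≤ κ_{N−1−k}` AND THE RELAXED COLOOP LIMIT (C1″); (H), (D) AND (A1κ⁺)
COINCIDE AT THE MIDDLE LEVEL OF AN EVEN GROUND SET; THE REGIMES OF (H) (p10, gen 26)

For a finite matroid `M` on `N = #E` elements and a point `p`, `κ_k = capCount M k p` is the number of `p`-avoiding
bi-independent `k`-sets capturing `p` (`p ∈ cl X`), `out_k = κ_k + c^p_k` (`capCount_add_extCount`) with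
`c^p_k = c^p_{N−1−k}` (`extCount_symm`).  p5's `CapMirror` (ProfilePointedMirror) is THE MIRROR STATEMENT **(H)**
`κ_k ≤ κ_{N−1−k}` for `2k + 2 ≤ N`, equivalent by p5's mirror identity `out_k + κ_{N−1−k} = in_{k+1} + κ_k` to the
per-point form `out_k ≤ in_{k+1}` of Theorem A (`BiIndepPointed`); its sum over the points is Theorem A's unimodal
form.  THIS FILE adds, all unconditional unless marked:

* **(C1″)** `CapLimitPlus` (NOT asserted): `(N − 1)·Σ_k κ_k ≤ 2·Σ_k k·κ_k`, i.e. `Σ_{X ∈ 𝒦} (2#X − N + 1) ≥ 0` — gen 15's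
  refuted (C1′) `CapLimit` relaxed by one per captured set; the coloop limit of conjecture (D) at the middle (gen 25),
  0 violations on ≤ 9 elements; and **(H) ⟹ (C1″)** (`capLimitPlus_of_capMirror`: pair each level with its mirror).
* **At the middle level `2k + 2 = N` the three statements (H)_k, (D)_k, (A1κ⁺)_k are the SAME inequality
  `κ_k ≤ κ_{k+1}`** (`avoidRow_level_iff_capCount_le_of_mid`, `capRowPlus_level_iff_capCount_le_of_mid`,
  `capMirror_level_iff_capCount_le_of_mid`): there `c^p_k = c^p_{k+1}` and `N − 1 − k = k + 1`.
* Regimes of (H): `κ_k = 0` when every `(k+1)`-subset through `p` is independent (`capCount_eq_zero_of_indep_succ_mem`),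
  so (H) is open only in the CAPTURE regime; at a parallel pair the captured profile is symmetric, `κ_k = κ_{N−k}`
  (`capCount_parallel_symm`, gen 16's swap as a bijection of the levels), `out_k = κ_k = P_{k−1}((M ∖ p) / e)`
  (`outCount_parallel_eq`), and both (D) and (H) hold there modulo Theorem A for the two-element minor
  (`avoidRow_level_parallel_of_fact`, `capMirror_level_parallel_of_fact`).

DATA (this gen, own exact code): p5's sharp form (MIRκ) `CapMirrorSharp` `(N − 1 − k)·κ_k ≤ k·κ_{N−1−k}` FAILS at
`M(K_{2,9}) + (h₁ + g₂) ⊕ U_{115,115}` (`N = 134`, level `63`; it is gen 21's (A1κ)-witness — at the middle (MIRκ) and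
(A1κ) are the same inequality), while (H) holds on that family for every `c ≤ 2,000`.  Nothing here asserts (H), (C1′),
(C1″), (D), (A1κ⁺) or (Ĉ).
-/

open scoped Matroid

namespace PercRepro.Cogirth

open Finset ThmH Skew

variable {α : Type} [DecidableEq α] {M : Matroid α} [M.Finite]

/-! ### (H) at one pointed matroid; the level-wise per-point form -/

/-- (H) at every level of one pointed matroid (p5's `CapMirror` is the statement for every matroid on `α`). -/
def CapMirrorAt (M : Matroid α) [M.Finite] (p : α) : Prop :=
  ∀ k : ℕ, 2 * k + 2 ≤ (gr M).card → capCount M k p ≤ capCount M ((gr M).card - (k + 1)) p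

/-- The level-wise per-point form of Theorem A, `out_k ≤ in_{k+1}`, is the mirror inequality `κ_k ≤ κ_{N−1−k}`
(p5's mirror identity). -/
theorem outCount_le_inCount_succ_iff {p : α} (hp : p ∈ gr M) {k : ℕ} (hk : k + 1 ≤ (gr M).card) :
    outCount M k p ≤ inCount M (k + 1) p ↔ capCount M k p ≤ capCount M ((gr M).card - (k + 1)) p := by
  have h := outCount_add_capCount_mirror (M := M) k hp hk
  omega

/-! ### (C1″) and (H) ⟹ (C1″) -/

/-- **(C1″) (NOT asserted)**: `(N − 1)·Σ_k κ_k ≤ 2·Σ_k k·κ_k` for every finite matroid on `α` and every point —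
(C1′) relaxed by one per captured set. -/
def CapLimitPlus (α : Type) [DecidableEq α] : Prop :=
  ∀ (M : Matroid α) [M.Finite] (p : α), p ∈ gr M →
    ((gr M).card - 1) * ∑ k ∈ range ((gr M).card + 1), capCount M k p ≤
      2 * ∑ k ∈ range ((gr M).card + 1), k * capCount M k p

/-- (C1′) ⟹ (C1″). -/
theorem capLimitPlus_of_capLimit (h : CapLimit α) : CapLimitPlus α := by
  intro M _ p hp
  calc ((gr M).card - 1) * ∑ k ∈ range ((gr M).card + 1), capCount M k p
      ≤ (gr M).card * ∑ k ∈ range ((gr M).card + 1), capCount M k p :=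
        Nat.mul_le_mul_right _ (Nat.sub_le _ _)
    _ ≤ 2 * ∑ k ∈ range ((gr M).card + 1), k * capCount M k p := h M p hp

/-- No captured set has `N` elements (it avoids `p ∈ E`). -/
theorem capCount_card_eq_zero {p : α} (hp : p ∈ gr M) : capCount M (gr M).card p = 0 := by
  unfold capCount
  rw [card_eq_zero, filter_eq_empty_iff]
  intro X hX hX'
  rw [mem_biIndepSets] at hX
  have hXeq : X = gr M := eq_of_subset_of_card_le hX.1 (by rw [hX.2.1])
  exact hX'.1 (hXeq ▸ hp)

/-- **(H) AT `(M, p)` GIVES (C1″) AT `(M, p)`**: pairing each level `k` with its mirror `N − 1 − k`, the signed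
first moment `Σ_k (2k − N + 1)·κ_k` is a sum of non-negative terms (gen 15's `sum_mirror_nonneg` on `N − 1`). -/
theorem capLimitPlus_body_of_capMirrorAt {p : α} (hp : p ∈ gr M) (h : CapMirrorAt M p) :
    ((gr M).card - 1) * ∑ k ∈ range ((gr M).card + 1), capCount M k p ≤
      2 * ∑ k ∈ range ((gr M).card + 1), k * capCount M k p := by
  obtain ⟨n, hn⟩ : ∃ n, (gr M).card = n + 1 := ⟨(gr M).card - 1, by
    have := card_pos.2 ⟨p, hp⟩
    omega⟩
  have htop : capCount M (n + 1) p = 0 := by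
    have := capCount_card_eq_zero (M := M) hp
    rwa [hn] at this
  have h1 := sum_mirror_nonneg n (fun k => capCount M k p) (fun k hk => by
    have := h k (by omega)
    rwa [hn, show n + 1 - (k + 1) = n - k by omega] at this)
  have hsum1 : ∑ k ∈ range (n + 1 + 1), capCount M k p = ∑ k ∈ range (n + 1), capCount M k p := by
    rw [sum_range_succ, htop, add_zero]
  have hsum2 : ∑ k ∈ range (n + 1 + 1), k * capCount M k p = ∑ k ∈ range (n + 1), k * capCount M k p := by
    rw [sum_range_succ, htop, mul_zero, add_zero]
  rw [hn, show n + 1 - 1 = n by omega, hsum1, hsum2]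
  have h2 : ∑ k ∈ range (n + 1), ((2 * (k : ℤ) - n) * (capCount M k p : ℤ)) =
      2 * ((∑ k ∈ range (n + 1), k * capCount M k p : ℕ) : ℤ) -
        (n : ℤ) * ((∑ k ∈ range (n + 1), capCount M k p : ℕ) : ℤ) := by
    push_cast
    rw [mul_sum, mul_sum, ← sum_sub_distrib]
    apply sum_congr rfl
    intro k _
    ring
  rw [h2] at h1
  have h3 : ((n * ∑ k ∈ range (n + 1), capCount M k p : ℕ) : ℤ) ≤
      ((2 * ∑ k ∈ range (n + 1), k * capCount M k p : ℕ) : ℤ) := by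
    push_cast
    push_cast at h1
    linarith
  exact_mod_cast h3

/-- **(H) ⟹ (C1″)**. -/
theorem capLimitPlus_of_capMirror (h : CapMirror α) : CapLimitPlus α :=
  fun M _ p hp => capLimitPlus_body_of_capMirrorAt hp (fun k hk => h M p k hp hk)

/-! ### The middle level of an even ground set: (H), (D) and (A1κ⁺) coincide -/

/-- At `2k + 2 = N` the compensations agree, `c^p_k = c^p_{k+1}` (the profile of `M / p` on `2k + 1` elements). -/
theorem extCount_succ_eq_of_mid {p : α} (hp : p ∈ gr M) {k : ℕ} (hk : 2 * k + 2 = (gr M).card) :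
    extCount M k p = extCount M (k + 1) p := by
  have := extCount_symm hp k (by omega)
  rwa [show (gr M).card - 1 - k = k + 1 by omega] at this

/-- **(D) AT THE MIDDLE LEVEL ⟺ `κ_k ≤ κ_{k+1}`** (`2k + 2 = N`; unconditional). -/
theorem avoidRow_level_iff_capCount_le_of_mid {p : α} (hp : p ∈ gr M) {k : ℕ} (hk : 2 * k + 2 = (gr M).card) :
    ((gr M).card - k - 1) * outCount M k p ≤ (k + 1) * outCount M (k + 1) p ↔
      capCount M k p ≤ capCount M (k + 1) p := by
  rw [← capCount_add_extCount k hp, ← capCount_add_extCount (k + 1) hp, show (gr M).card - k - 1 = k + 1 by omega,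
    ← extCount_succ_eq_of_mid hp hk]
  constructor
  · intro h
    have := Nat.le_of_mul_le_mul_left h (Nat.succ_pos k)
    omega
  · intro h
    exact Nat.mul_le_mul_left _ (by omega)

/-- **(A1κ⁺) AT THE MIDDLE LEVEL ⟺ `κ_k ≤ κ_{k+1}`** (`2k + 2 = N`). -/
theorem capRowPlus_level_iff_capCount_le_of_mid {p : α} {k : ℕ} (hk : 2 * k + 2 = (gr M).card) :
    ((gr M).card - k - 1) * capCount M k p ≤ (k + 1) * capCount M (k + 1) p ↔
      capCount M k p ≤ capCount M (k + 1) p := by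
  rw [show (gr M).card - k - 1 = k + 1 by omega]
  constructor
  · intro h
    exact Nat.le_of_mul_le_mul_left h (Nat.succ_pos k)
  · intro h
    exact Nat.mul_le_mul_left _ h

/-- **(H) AT THE MIDDLE LEVEL ⟺ `κ_k ≤ κ_{k+1}`** (`2k + 2 = N`). -/
theorem capMirror_level_iff_capCount_le_of_mid {p : α} {k : ℕ} (hk : 2 * k + 2 = (gr M).card) :
    capCount M k p ≤ capCount M ((gr M).card - (k + 1)) p ↔ capCount M k p ≤ capCount M (k + 1) p := by
  rw [show (gr M).card - (k + 1) = k + 1 by omega]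

/-- **AT THE MIDDLE LEVEL OF AN EVEN GROUND SET, (D) AND (A1κ⁺) ARE THE SAME INEQUALITY** (unconditional). -/
theorem avoidRow_level_iff_capRowPlus_level_of_mid {p : α} (hp : p ∈ gr M) {k : ℕ}
    (hk : 2 * k + 2 = (gr M).card) :
    ((gr M).card - k - 1) * outCount M k p ≤ (k + 1) * outCount M (k + 1) p ↔
      ((gr M).card - k - 1) * capCount M k p ≤ (k + 1) * capCount M (k + 1) p := by
  rw [avoidRow_level_iff_capCount_le_of_mid hp hk, capRowPlus_level_iff_capCount_le_of_mid hk]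

/-- (H) at `(M, p)` gives (D) at the middle level of an even ground set. -/
theorem avoidRow_level_of_capMirrorAt_of_mid {p : α} (hp : p ∈ gr M) (h : CapMirrorAt M p) {k : ℕ}
    (hk : 2 * k + 2 = (gr M).card) :
    ((gr M).card - k - 1) * outCount M k p ≤ (k + 1) * outCount M (k + 1) p :=
  (avoidRow_level_iff_capCount_le_of_mid hp hk).2 ((capMirror_level_iff_capCount_le_of_mid hk).1 (h k (by omega)))

/-- (H) at `(M, p)` gives (A1κ⁺) at the middle level of an even ground set. -/
theorem capRowPlus_level_of_capMirrorAt_of_mid {p : α} (h : CapMirrorAt M p) {k : ℕ}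
    (hk : 2 * k + 2 = (gr M).card) :
    ((gr M).card - k - 1) * capCount M k p ≤ (k + 1) * capCount M (k + 1) p :=
  (capRowPlus_level_iff_capCount_le_of_mid hk).2 ((capMirror_level_iff_capCount_le_of_mid hk).1 (h k (by omega)))

/-! ### Regimes of (H) -/

/-- No `p`-avoiding bi-independent `k`-set captures `p` when every `(k+1)`-subset through `p` is independent. -/
theorem capCount_eq_zero_of_indep_succ_mem {k : ℕ} {p : α} (hp : p ∈ gr M)
    (h1 : ∀ X ⊆ gr M, p ∈ X → X.card = k + 1 → rk M X = X.card) : capCount M k p = 0 := by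
  have h := capCount_add_extCount k hp
  rw [extCount_eq_outCount_of_indep_succ_mem hp h1] at h
  omega

/-- (H) holds at level `k` when every `(k+1)`-subset through `p` is independent: the left side vanishes. -/
theorem capMirror_level_of_indep_succ_mem {k : ℕ} {p : α} (hp : p ∈ gr M)
    (h1 : ∀ X ⊆ gr M, p ∈ X → X.card = k + 1 → rk M X = X.card) :
    capCount M k p ≤ capCount M ((gr M).card - (k + 1)) p := by
  rw [capCount_eq_zero_of_indep_succ_mem hp h1]
  exact Nat.zero_le _

/-- **THE CAPTURED PROFILE IS SYMMETRIC AT A PARALLEL PAIR**: `κ_k = κ_{N−k}` for `k ≤ N` (gen 16's swap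
`X ↦ ((E ∖ X) ∖ p) ∪ e` is an involution of `𝒦` exchanging the levels `k` and `N − k`). -/
theorem capCount_parallel_symm {p e : α} (hp : p ∈ gr M) (he : e ∈ gr M) (hpe' : p ≠ e)
    (hp1 : rk M {p} = 1) (he1 : rk M {e} = 1) (hpe : rk M {p, e} = 1) {k : ℕ} (hk : k ≤ (gr M).card) :
    capCount M k p = capCount M ((gr M).card - k) p := by
  rw [← card_capSets_filter, ← card_capSets_filter]
  apply card_bij (fun X _ => parSwap M p e X)
  · intro X hX
    rw [mem_filter] at hX ⊢
    refine ⟨parSwap_mem_capSets hp he hpe' hp1 he1 hpe hX.1, ?_⟩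
    have := card_parSwap_add hp he hpe' hpe hX.1
    omega
  · intro X₁ hX₁ X₂ hX₂ heq
    rw [mem_filter] at hX₁ hX₂
    rw [← parSwap_parSwap hp he hpe' hpe hX₁.1, ← parSwap_parSwap hp he hpe' hpe hX₂.1, heq]
  · intro Y hY
    rw [mem_filter] at hY
    refine ⟨parSwap M p e Y, ?_, parSwap_parSwap hp he hpe' hpe hY.1⟩
    rw [mem_filter]
    refine ⟨parSwap_mem_capSets hp he hpe' hp1 he1 hpe hY.1, ?_⟩
    have := card_parSwap_add hp he hpe' hpe hY.1
    omega

/-- At a parallel pair `out_k = κ_k` (nothing extends by `p`). -/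
theorem outCount_eq_capCount_parallel {p e : α} (hp : p ∈ gr M) (he : e ∈ gr M) (hpe' : p ≠ e)
    (hpe : rk M {p, e} = 1) (k : ℕ) : outCount M k p = capCount M k p := by
  rw [← capCount_add_extCount k hp, extCount_parallel hp he hpe' hpe k, add_zero]

/-- At a parallel pair `p ∥ e` every `p`-avoiding bi-independent `k`-set contains `e`, so
`out_k = P_{k−1}((M ∖ p) / e)` for `k ≥ 1`. -/
theorem outCount_parallel_eq {p e : α} (hp : p ∈ gr M) (he : e ∈ gr M) (hpe' : p ≠ e)
    (hp1 : rk M {p} = 1) (he1 : rk M {e} = 1) (hpe : rk M {p, e} = 1) {k : ℕ} (hk : 1 ≤ k) :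
    outCount M k p = (biIndepSets ((M ＼ ({p} : Set α)) ／ ({e} : Set α)) (k - 1)).card := by
  rw [← card_filter_biIndepSets_parallel_half he hp hpe'.symm he1 hp1 (by rwa [pair_comm]) hk]
  unfold outCount
  apply congrArg Finset.card
  apply filter_congr
  intro X hX
  constructor
  · intro hpX
    refine ⟨?_, hpX⟩
    by_contra heX
    have hsub : ({p, e} : Finset α) ⊆ gr M \ X := by
      intro x hx
      rw [mem_insert, mem_singleton] at hx
      rcases hx with rfl | rfl
      · exact mem_sdiff.2 ⟨hp, hpX⟩
      · exact mem_sdiff.2 ⟨he, heX⟩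
    exact not_pair_subset_of_parallel' hpe' hpe (mem_biIndepSets.1 hX).2.2.2 hsub
  · exact fun h => h.2

/-- **(D) HOLDS AT EVERY PARALLEL PAIR** (mod Theorem A for the two-element minor `(M ∖ p) / e` on `N − 2`
elements): `out_k = P_{k−1}(M'')`, and `(N − k − 1)·P_{k−1}(M'') ≤ k·P_k(M'') ≤ (k + 1)·P_k(M'')`. -/
theorem avoidRow_level_parallel_of_fact (hfact : BiIndepDensityLogConcave α) {p e : α} (hp : p ∈ gr M)
    (he : e ∈ gr M) (hpe' : p ≠ e) (hp1 : rk M {p} = 1) (he1 : rk M {e} = 1) (hpe : rk M {p, e} = 1)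
    {k : ℕ} (hk : 2 * k + 2 ≤ (gr M).card) :
    ((gr M).card - k - 1) * outCount M k p ≤ (k + 1) * outCount M (k + 1) p := by
  rcases Nat.eq_zero_or_pos k with rfl | hk1
  · have h0 : outCount M 0 p = 0 := by
      unfold outCount
      rw [card_eq_zero, filter_eq_empty_iff]
      intro X hX hpX
      rw [mem_biIndepSets] at hX
      rw [card_eq_zero.1 hX.2.1, sdiff_empty] at hX
      exact not_pair_subset_of_parallel' hpe' hpe hX.2.2.2 (insert_subset hp (singleton_subset_iff.2 he))
    rw [h0, mul_zero]
    exact Nat.zero_le _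
  · rw [outCount_parallel_eq hp he hpe' hp1 he1 hpe hk1,
      outCount_parallel_eq hp he hpe' hp1 he1 hpe (by omega), show k + 1 - 1 = k by omega]
    have hN : (gr ((M ＼ ({p} : Set α)) ／ ({e} : Set α))).card = (gr M).card - 2 := by
      rw [gr_contract', gr_delete', card_erase_of_mem, card_erase_of_mem hp]
      · omega
      · exact mem_erase.2 ⟨hpe'.symm, he⟩
    have h := biIndepDensity_mono_of_fact hfact ((M ＼ ({p} : Set α)) ／ ({e} : Set α)) (k - 1)
      (by rw [hN]; omega)
    rw [hN, show (gr M).card - 2 - (k - 1) = (gr M).card - k - 1 by omega, show k - 1 + 1 = k by omega] at h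
    calc ((gr M).card - k - 1) * (biIndepSets ((M ＼ ({p} : Set α)) ／ ({e} : Set α)) (k - 1)).card
        ≤ k * (biIndepSets ((M ＼ ({p} : Set α)) ／ ({e} : Set α)) k).card := h
      _ ≤ (k + 1) * (biIndepSets ((M ＼ ({p} : Set α)) ／ ({e} : Set α)) k).card :=
        Nat.mul_le_mul_right _ (Nat.le_succ k)

/-- **(H) HOLDS AT EVERY PARALLEL PAIR** (mod Theorem A): by the symmetry `κ_{N−1−k} = κ_{k+1}` it is the step
`κ_k ≤ κ_{k+1}`, i.e. `out_k ≤ out_{k+1}`, which (D) at level `k` gives for `2k + 2 ≤ N`. -/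
theorem capMirror_level_parallel_of_fact (hfact : BiIndepDensityLogConcave α) {p e : α} (hp : p ∈ gr M)
    (he : e ∈ gr M) (hpe' : p ≠ e) (hp1 : rk M {p} = 1) (he1 : rk M {e} = 1) (hpe : rk M {p, e} = 1)
    {k : ℕ} (hk : 2 * k + 2 ≤ (gr M).card) :
    capCount M k p ≤ capCount M ((gr M).card - (k + 1)) p := by
  have hsym := capCount_parallel_symm hp he hpe' hp1 he1 hpe (k := k + 1) (by omega)
  rw [← hsym]
  have hD := avoidRow_level_parallel_of_fact hfact hp he hpe' hp1 he1 hpe (k := k) hk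
  rw [outCount_eq_capCount_parallel hp he hpe' hpe, outCount_eq_capCount_parallel hp he hpe' hpe] at hD
  have h2 : (k + 1) * capCount M k p ≤ ((gr M).card - k - 1) * capCount M k p :=
    Nat.mul_le_mul_right _ (by omega)
  exact Nat.le_of_mul_le_mul_left (h2.trans hD) (Nat.succ_pos k)

/-- (H) at every level of a parallel pair, mod Theorem A. -/
theorem capMirrorAt_parallel_of_fact (hfact : BiIndepDensityLogConcave α) {p e : α} (hp : p ∈ gr M)
    (he : e ∈ gr M) (hpe' : p ≠ e) (hp1 : rk M {p} = 1) (he1 : rk M {e} = 1) (hpe : rk M {p, e} = 1) :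
    CapMirrorAt M p :=
  fun _ hk => capMirror_level_parallel_of_fact hfact hp he hpe' hp1 he1 hpe hk

end PercRepro.Cogirth
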